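import Summits.Ventures.GridStability.Models.GFMSMIBTwinVICCT

/-!
# GridStability/Models/GFMSMIBTwinCSACCT — the twin «GFM-SMIB-QoriaV5s» WITH THE CURRENT SATURATION ALGORITHM after clearing: `0.24 s ≤ CCT(M_twin+CSA) ≤ 0.35 s`, and the certified RANKING with inertial effect `CCT_CSA < CCT_VI < CCT_unlimited` (Qoria Table V-2 «CSA −, VI +» for the `H_VSC = 5 s` converter)

Cell `gridfusion` (LADDER-GRIDFUSION rung G3.a, thread «G3.a-cct»; seat gridfusion-model-3 (g10)).  Third member of
the twin's clearing-time family after ★ #114 (no limiter, `[0.70, 0.74]` s) and ★ #123 (virtual impedance,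
`[0.44, 0.58]` s, PRINTED 498 ms): post-fault the converter sits on the CURRENT-SATURATED branch
`p_mes = P_max3 cos δ`, `P_max3 = I_maxSAT V_e = 6/5` [cite: Qoria2020, §V.3.3 (V-22)–(V-23), Table V-1] — in the
shifted angle `δ′ = δ + π/2` (`cos δ = sin(δ + π/2)`) the classical SMIB `gfmQoriaV5sSAT = ⟨113/3550, 113/1420,
p*′, 0, 6/5, 0⟩` with equilibrium `δ′₁ = arcsin(5p*′/6) = arcsin(6908800/16581121)` (`0.42 < δ′₁ < 0.44`,
converter angle `δ′₁ − π/2 = −1.141 = −δ_maxSAT(p*′)`: g9's «current-saturated rest angle» of `sat_rest`,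
p549392 §4b) — SAME closed-form fault-on arc `X_F(T)`; ALL data printed or already of record (no composition
beyond P-INV-7).  CERTIFIED:
* `twinSAT_cct_lower` — every `T ≤ 6/25` s: with the CSA kept active the motion keeps the saturated-branch window,
  `V_SAT ≤ 1 < V_cr,SAT` (`1.0309 < V_cr,SAT < 1.051`) and tends to the saturated rest point (energy well ∘ arc;
  `e^{−3/5} ∈ [0.5488116, 0.5488117]`, shifted arc angle `≤ 2.0703`, `V ≤ 0.128 + 0.8521`);
* `twinSAT_poleSlip_of_clearing_ge` — every `T ≥ 7/20` s: pole slip on the saturated branch (lit-1 excess criterion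
  at the corner `(2.4296, 3.6639)`, `e^{−7/8} ∈ [0.4168618, 0.4168621]`, `V_PE(2.4296) ≥ 0.994`, allowance
  `≤ 0.0852`, `m = 1/100`, margin 0.06);  `twinSAT_cct_bracket`;
* `twin_limiter_ranking` — the three brackets in one statement: every `T ≥ 0.35` slips under the CSA while every
  `T ≤ 0.44` relocks under the VI (#123), every `T ≥ 0.58` slips under the VI while every `T ≤ 0.70` recovers without
  limiter (#114): `CCT(M_twin+CSA) ≤ 0.35 < 0.44 ≤ CCT(M_twin+VI) ≤ 0.58 < 0.70 ≤ CCT(M_twin)` — the print's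
  Table V-2 ranking, established there for the inertia-less model, as certified inequalities WITH inertial effect.
THREE COLUMNS.  CERTIFIED: about MODEL M_twin+CSA (droop GFM ≡ SMIB twin, MV-6D + MV-P + MV-Ω + P-INV-7; post-fault
on the saturated branch (V-22), CSA ACTIVE THROUGHOUT — the release at the crossing point (d) is the companion
file's rider; bolted terminal fault from `(δˢ, 0)`).  VALIDATED (floats, never used): RK4 on M_twin+CSA puts the
model's CCT at `0.296 s`, the same with the printed release rule (unsaturated once `4 sin δ ≤ (6/5) cos δ` on the
way back); no printed comparator (the thesis prints CSA clearing times for `H ∼ 0` only: 63.7 ms at `p* = 0.8`).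
MODELLED: a relock «on the saturated branch» is at the current-saturated angle `−65°` of the MODEL — whether a real
limiter stays engaged there is outside M (MV-INV); nothing here says a converter is stable or unstable.
-/

noncomputable section

open Real Set Filter Topology
open Summit.Ventures.GridStability.Models.AngleEnclosure

namespace Summit.Ventures.GridStability.Models.SMIB

open InverterDroop

/-! ## §1 The CSA-shifted record -/

/-- **The twin on its current-saturated branch, as an SMIB in the shifted angle `δ′ = δ + π/2`:**
`M δ̈ + D δ̇ = p*′ − (6/5) cos δ = p*′ − (6/5) sin(δ + π/2)` [cite: Qoria2020, (V-22)–(V-23), Table V-1 «I_maxSAT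
= 1.2»]. MODELLED: MV-6D + MV-P + MV-Ω + P-INV-7; CSA active. -/
def gfmQoriaV5sSAT : SMIB where
  M := (113 : ℝ) / 3550
  D := (113 : ℝ) / 1420
  Pm := (8290560 : ℝ) / 16581121
  PC := 0
  PM := (6 : ℝ) / 5
  γ := 0

/-- The saturated rest angle in the shifted frame: `δ′₁ = arcsin(p*′/P_max3) = arcsin(6908800/16581121)`. -/
def twinSAT_δ1 : ℝ := arcsin (6908800 / 16581121)

/-- `sin δ′₁ = 6908800/16581121` (`= 5p*′/6`). -/
theorem sin_twinSAT_δ1 : sin twinSAT_δ1 = 6908800 / 16581121 := by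
  unfold twinSAT_δ1; rw [sin_arcsin] <;> norm_num

/-- `cos δ′₁ = √(1 − (5p*′/6)²)` and its certified enclosure `0.90905 < cos δ′₁ < 0.90907`. -/
theorem cos_twinSAT_δ1_bounds : (90905 / 100000 : ℝ) < cos twinSAT_δ1 ∧ cos twinSAT_δ1 < 90907 / 100000 := by
  have hpos : 0 < cos twinSAT_δ1 := by
    unfold twinSAT_δ1
    rw [Real.cos_arcsin]
    exact Real.sqrt_pos.2 (by norm_num)
  have hsq : cos twinSAT_δ1 ^ 2 = 1 - (6908800 / 16581121 : ℝ) ^ 2 := by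
    rw [cos_sq', sin_twinSAT_δ1]
  constructor <;> nlinarith

/-- Certified `0.42 < δ′₁ < 0.44` (`Real.sin_bound` at the two rationals; float `0.42978`). -/
theorem twinSAT_δ1_bounds : (42 / 100 : ℝ) < twinSAT_δ1 ∧ twinSAT_δ1 < 44 / 100 := by
  unfold twinSAT_δ1
  have hb1 := Real.sin_bound (x := (42 / 100 : ℝ)) (by rw [abs_le]; constructor <;> norm_num)
  have hb2 := Real.sin_bound (x := (44 / 100 : ℝ)) (by rw [abs_le]; constructor <;> norm_num)
  rw [abs_le] at hb1 hb2
  norm_num at hb1 hb2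
  constructor
  · rw [Real.lt_arcsin_iff_sin_lt ⟨by linarith [pi_gt_three], by linarith [pi_gt_three]⟩
      ⟨by norm_num, by norm_num⟩]
    linarith [hb1.2]
  · rw [Real.arcsin_lt_iff_lt_sin ⟨by norm_num, by norm_num⟩
      ⟨by linarith [pi_gt_three], by linarith [pi_gt_three]⟩]
    linarith [hb2.1]

/-- `0 < δ′₁ < π/2`. -/
theorem twinSAT_δ1_mem : 0 < twinSAT_δ1 ∧ twinSAT_δ1 < π / 2 := by
  constructor <;> linarith [pi_gt_three, twinSAT_δ1_bounds.1, twinSAT_δ1_bounds.2]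

/-- `γ = 0`. -/
theorem gfmQoriaV5sSAT_γ : gfmQoriaV5sSAT.γ = 0 := rfl

/-- lit-2 reading `⟨113/3550, 113/1420, p*′, 6/5⟩`. -/
theorem gfmQoriaV5sSAT_toLit :
    gfmQoriaV5sSAT.toLit = ⟨113 / 3550, 113 / 1420, 8290560 / 16581121, 6 / 5⟩ := by
  simp only [toLit, gfmQoriaV5sSAT, sub_zero]

/-- `δ′₁` is the equilibrium angle (`(6/5) sin δ′₁ = p*′`). -/
theorem gfmQoriaV5sSAT_isEquilibrium : gfmQoriaV5sSAT.IsEquilibrium twinSAT_δ1 := by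
  rw [isEquilibrium_iff]
  simp only [gfmQoriaV5sSAT, sub_zero, sin_twinSAT_δ1]
  norm_num

/-- Certified `1.0309 < V_cr,SAT < 1.051` (`V_cr,SAT = −p*′(π − 2δ′₁) + (12/5) cos δ′₁`; float `1.0407` — a sixth of
the unlimited well `6.49`, twice the VI well `0.48`). -/
theorem twinSAT_criticalEnergy_bounds :
    (10309 / 10000 : ℝ) < gfmQoriaV5sSAT.toLit.criticalEnergy twinSAT_δ1 ∧
      gfmQoriaV5sSAT.toLit.criticalEnergy twinSAT_δ1 < 1051 / 1000 := by
  rw [Literature.MathematicalPhysics.PowerSystems.SMIB.criticalEnergy, gfmQoriaV5sSAT_toLit]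
  obtain ⟨h1, h2⟩ := twinSAT_δ1_bounds
  obtain ⟨h3, h4⟩ := cos_twinSAT_δ1_bounds
  have hπ1 := pi_gt_d6
  have hπ2 := pi_lt_d6
  norm_num at hπ1 hπ2 ⊢
  constructor <;> nlinarith

/-- **The twin on its saturated branch IS the shifted SMIB:** the field at `(δ + π/2, ω)` is
`(ω, (p*′ − (6/5) cos δ − D ω)/M)` — model-3's `pSaturated`/(V-22) in the twin's SMIB units. [cite: Qoria2020, (V-22)] -/
theorem gfmQoriaV5sSAT_field_shift (δ ω : ℝ) :
    gfmQoriaV5sSAT.field (δ + π / 2, ω) =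
      (ω, ((8290560 / 16581121 : ℝ) - 6 / 5 * cos δ - (113 / 1420) * ω) / (113 / 3550)) := by
  simp only [field, Pe, gfmQoriaV5sSAT, sub_zero, zero_add, Real.sin_add_pi_div_two]

/-! ## §2 The bracket (CSA kept active) -/

/-- **Shifted fault-on angle and CSA energy at `T ≤ 6/25`:** angle `δ_F + π/2 ∈ [1.696, 2.0703] ⊂ (δ′₁, π − δ′₁)`,
energy `≤ 1` (kinetic `≤ 16/125`, potential `≤ 0.8521`, monotone on the arc). -/
theorem twinSAT_faultOn_energy_le {T : ℝ} (hT0 : 0 ≤ T) (hT : T ≤ 6 / 25) :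
    (1696 / 1000 : ℝ) ≤ (twinFaultOnState T).1 + π / 2 ∧ (twinFaultOnState T).1 + π / 2 ≤ 20703 / 10000 ∧
      gfmQoriaV5sSAT.energy twinSAT_δ1 ((twinFaultOnState T).1 + π / 2, (twinFaultOnState T).2) ≤ 1 := by
  have hE : (1372029 / 2500000 : ℝ) ≤ exp (-(3 / 5)) ∧ exp (-(3 / 5)) ≤ 5488117 / 10000000 := by
    have h := Real.exp_bound (x := -(3 / 5 : ℝ)) (by rw [abs_le]; constructor <;> norm_num) (n := 10) (by norm_num)
    simp only [Finset.sum_range_succ, Finset.sum_range_zero, Nat.factorial, Nat.succ_eq_add_one] at h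
    norm_num at h
    rw [abs_le] at h
    constructor <;> linarith [h.1, h.2]
  have hδs1 := deltaQV4_gt
  have hδs2 := deltaQV4_lt
  obtain ⟨hd1, hd2⟩ := twinSAT_δ1_bounds
  obtain ⟨hc1, hc2⟩ := cos_twinSAT_δ1_bounds
  have hπ1 := pi_gt_d6
  have hπ2 := pi_lt_d6
  norm_num at hπ1 hπ2
  have hkp : (0 : ℝ) < kpTwin := by norm_num [kpTwin]
  have hbr0 : 0 ≤ T - (1 - exp (-(5 / 2) * T)) / (5 / 2) := by
    have h1 : 1 - exp (-((5 / 2) * T)) ≤ (5 / 2) * T := by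
      have := add_one_le_exp (-((5 / 2) * T)); linarith
    rw [show -(5 / 2 : ℝ) * T = -((5 / 2) * T) by ring, sub_nonneg, div_le_iff₀ (by norm_num : (0:ℝ) < 5 / 2)]
    linarith
  have hbr1 : T - (1 - exp (-(5 / 2) * T)) / (5 / 2) ≤ 6 / 25 - (1 - exp (-(5 / 2) * (6 / 25))) / (5 / 2) :=
    faultOn_bracket_mono (by norm_num) hT0 hT
  have h625 : exp (-(5 / 2 : ℝ) * (6 / 25)) = exp (-(3 / 5)) := by norm_num
  rw [h625] at hbr1
  have hang_lo : (1696 / 1000 : ℝ) ≤ (twinFaultOnState T).1 + π / 2 := by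
    simp only [twinFaultOnState]; nlinarith
  have hang_hi : (twinFaultOnState T).1 + π / 2 ≤ 20703 / 10000 := by
    simp only [twinFaultOnState]
    have : kpTwin * (T - (1 - exp (-(5 / 2) * T)) / (5 / 2))
        ≤ kpTwin * (6 / 25 - (1 - exp (-(3 / 5))) / (5 / 2)) := mul_le_mul_of_nonneg_left hbr1 hkp.le
    norm_num [kpTwin] at this hE ⊢
    nlinarith [hE.2]
  refine ⟨hang_lo, hang_hi, ?_⟩
  have hexpT : exp (-(3 / 5)) ≤ exp (-(5 / 2) * T) := by rw [exp_le_exp]; nlinarith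
  have hexpT1 : exp (-(5 / 2) * T) ≤ 1 := by rw [exp_le_one_iff]; nlinarith
  have hΩ0 : 0 ≤ (twinFaultOnState T).2 := by
    simp only [twinFaultOnState]; exact mul_nonneg hkp.le (by linarith)
  have hΩ1 : (twinFaultOnState T).2 ≤ kpTwin * (1 - 1372029 / 2500000) := by
    simp only [twinFaultOnState]; exact mul_le_mul_of_nonneg_left (by linarith [hE.1]) hkp.le
  have hKE : (113 : ℝ) / 3550 * (twinFaultOnState T).2 ^ 2 / 2 ≤ 16 / 125 := by
    have h2 : (twinFaultOnState T).2 ^ 2 ≤ (kpTwin * (1 - 1372029 / 2500000)) ^ 2 := pow_le_pow_left₀ hΩ0 hΩ1 2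
    norm_num [kpTwin] at h2 ⊢
    nlinarith
  set p := gfmQoriaV5sSAT.toLit with hp
  have hpv : p = ⟨113 / 3550, 113 / 1420, 8290560 / 16581121, 6 / 5⟩ := gfmQoriaV5sSAT_toLit
  set d' := (twinFaultOnState T).1 + π / 2 with hd'
  have heq : p.IsEquilibriumAngle twinSAT_δ1 :=
    (toLit_isEquilibriumAngle_iff gfmQoriaV5sSAT_γ twinSAT_δ1).2 gfmQoriaV5sSAT_isEquilibrium
  have hmono := p.potentialEnergy_monotoneOn_arc (by rw [hpv]; norm_num) heq twinSAT_δ1_mem.1.le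
    twinSAT_δ1_mem.2.le ⟨by linarith, by linarith⟩ ⟨by linarith, by linarith⟩ hang_hi
  have hcos : cosLower4 (20703 / 10000) ≤ cos (20703 / 10000 : ℝ) :=
    cosLower4_le_cos _ (by norm_num [dbl]) (by norm_num [dbl]) (by norm_num [dbl]) (by norm_num [dbl])
  have hpot : p.potentialEnergy twinSAT_δ1 d' ≤ 8521 / 10000 := by
    refine hmono.trans ?_
    rw [hpv]
    unfold Literature.MathematicalPhysics.PowerSystems.SMIB.potentialEnergy
    norm_num [dbl, cosLower4] at hcos hd2 hc2 ⊢
    nlinarith [hcos, hc2]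
  have hEn : gfmQoriaV5sSAT.energy twinSAT_δ1 (d', (twinFaultOnState T).2)
      = (113 : ℝ) / 3550 * (twinFaultOnState T).2 ^ 2 / 2 + p.potentialEnergy twinSAT_δ1 d' := by
    rw [← toLit_energy gfmQoriaV5sSAT_γ, ← hp]
    unfold Literature.MathematicalPhysics.PowerSystems.SMIB.energy
    rw [hpv]; ring
  rw [hEn]
  linarith

/-- **Certified clearing time ≥ 0.24 s for MODEL M_twin+CSA (CSA active after clearing).**  Every `T ≤ 6/25` s: every
solution of the CSA-shifted record on `[0, ∞)` from `X_F(T) + (π/2, 0)` keeps `δ + π/2 ∈ (−π − δ′₁, π − δ′₁)`,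
`V_SAT ≤ 1`, and tends to `(δ′₁, 0)` — converter angle `δ′₁ − π/2` (the current-saturated rest angle).  MODELLED:
M_twin+CSA; nothing about a device. [cite: Qoria2020, §V.3.3 (V-22), §V.3.6] -/
theorem twinSAT_cct_lower {T : ℝ} (hT0 : 0 ≤ T) (hT : T ≤ 6 / 25) {Y : ℝ → ℝ × ℝ}
    (hY : gfmQoriaV5sSAT.IsSolutionOn Y (Ici 0))
    (h0 : Y 0 = ((twinFaultOnState T).1 + π / 2, (twinFaultOnState T).2)) :
    (∀ t, 0 ≤ t → (Y t).1 ∈ Ioo (-π - twinSAT_δ1) (π - twinSAT_δ1) ∧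
        gfmQoriaV5sSAT.energy twinSAT_δ1 (Y t) ≤ 1) ∧
      Tendsto Y atTop (𝓝 (twinSAT_δ1, 0)) := by
  obtain ⟨hlo, hhi, hE⟩ := twinSAT_faultOn_energy_le hT0 hT
  have hd := twinSAT_δ1_bounds
  refine energyWell_roa_Ici (p := gfmQoriaV5sSAT) rfl (by norm_num [gfmQoriaV5sSAT])
    (by norm_num [gfmQoriaV5sSAT]) (by norm_num [gfmQoriaV5sSAT])
    gfmQoriaV5sSAT_isEquilibrium twinSAT_δ1_mem.1.le twinSAT_δ1_mem.2
    (lt_trans (by norm_num) twinSAT_criticalEnergy_bounds.1) hY ?_ ?_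
  · rw [h0]
    have hπ2 := pi_lt_d6
    norm_num at hπ2
    constructor <;> (dsimp only; linarith [pi_gt_three])
  · rw [h0]; exact hE

/-- **Every clearing time `T ≥ 0.35 s` ends in a pole slip for MODEL M_twin+CSA.**  Every `T ≥ 7/20` s, every
solution of the CSA-shifted record on `[0, ∞)` from `X_F(T) + (π/2, 0)`: `(Y t).1 − δ′₁ > π` at some `t ≥ 0`
(lit-1's excess criterion in threshold form at the corner `(2.4296, 3.6639)`, `m = 1/100`).  MODELLED: M_twin+CSA.
[cite: SauerPai1998, §9.6.2 (text after (9.36)), §9.6.3 (9.48); Qoria2020, §V.3.3] -/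
theorem twinSAT_poleSlip_of_clearing_ge {T : ℝ} (hT : 7 / 20 ≤ T) {Y : ℝ → ℝ × ℝ}
    (hY : gfmQoriaV5sSAT.IsSolutionOn Y (Ici 0))
    (h0 : Y 0 = ((twinFaultOnState T).1 + π / 2, (twinFaultOnState T).2)) :
    ∃ t : ℝ, 0 ≤ t ∧ π < (Y t).1 - twinSAT_δ1 := by
  set p := gfmQoriaV5sSAT.toLit with hp
  have hpv : p = ⟨113 / 3550, 113 / 1420, 8290560 / 16581121, 6 / 5⟩ := gfmQoriaV5sSAT_toLit
  have hM : 0 < p.M := by rw [hpv]; norm_num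
  have hD : 0 ≤ p.D := by rw [hpv]; norm_num
  have hPmax : 0 < p.Pmax := by rw [hpv]; norm_num
  have heq : p.IsEquilibriumAngle twinSAT_δ1 :=
    (toLit_isEquilibriumAngle_iff gfmQoriaV5sSAT_γ twinSAT_δ1).2 gfmQoriaV5sSAT_isEquilibrium
  have hXlit : ∀ S : ℝ, ∀ t ∈ Icc 0 S, HasDerivWithinAt Y (p.vectorField (Y t)) (Icc 0 S) t :=
    fun S => (isSolutionOn_iff_toLit gfmQoriaV5sSAT_γ Y _).1 (hY.restrict_Icc S)
  obtain ⟨hd1, hd2⟩ := twinSAT_δ1_bounds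
  obtain ⟨hc1, hc2⟩ := cos_twinSAT_δ1_bounds
  have hδs1 := deltaQV4_gt
  have hπlo := Real.pi_gt_d6
  have hπhi := Real.pi_lt_d6
  norm_num at hπlo hπhi
  have hkp : (0 : ℝ) < kpTwin := by norm_num [kpTwin]
  -- e^{−7/8} and the corner, valid for every T ≥ 7/20
  have hE : (4168618 / 10000000 : ℝ) ≤ exp (-(7 / 8)) ∧ exp (-(7 / 8)) ≤ 4168621 / 10000000 := by
    have h := Real.exp_bound (x := -(7 / 8 : ℝ)) (by rw [abs_le]; constructor <;> norm_num) (n := 10) (by norm_num)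
    simp only [Finset.sum_range_succ, Finset.sum_range_zero, Nat.factorial, Nat.succ_eq_add_one] at h
    norm_num at h
    rw [abs_le] at h
    constructor <;> linarith [h.1, h.2]
  have h720 : exp (-(5 / 2 : ℝ) * (7 / 20)) = exp (-(7 / 8)) := by norm_num
  have hexpT : exp (-(5 / 2) * T) ≤ exp (-(7 / 8)) := by rw [exp_le_exp]; nlinarith
  have hbr : (7 : ℝ) / 20 - (1 - exp (-(5 / 2) * (7 / 20))) / (5 / 2) ≤ T - (1 - exp (-(5 / 2) * T)) / (5 / 2) :=
    faultOn_bracket_mono (by norm_num) (by norm_num) hT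
  rw [h720] at hbr
  have hωlo : (36639 / 10000 : ℝ) ≤ (twinFaultOnState T).2 := by
    have hc : (36639 / 10000 : ℝ) ≤ kpTwin * (1 - exp (-(7 / 8))) := by
      norm_num [kpTwin] at hE ⊢; nlinarith [hE.2]
    have hm : kpTwin * (1 - exp (-(7 / 8))) ≤ kpTwin * (1 - exp (-(5 / 2) * T)) :=
      mul_le_mul_of_nonneg_left (by linarith [hexpT]) hkp.le
    simp only [twinFaultOnState]
    exact hc.trans hm
  have hδlo : (3037 / 1250 : ℝ) ≤ (twinFaultOnState T).1 + π / 2 := by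
    have hc : (3037 / 1250 : ℝ) ≤ 1253 / 10000 + 3141592 / 1000000 / 2 +
        kpTwin * (7 / 20 - (1 - exp (-(7 / 8))) / (5 / 2)) := by
      norm_num [kpTwin] at hE ⊢; nlinarith [hE.1]
    have hm : kpTwin * (7 / 20 - (1 - exp (-(7 / 8))) / (5 / 2)) ≤
        kpTwin * (T - (1 - exp (-(5 / 2) * T)) / (5 / 2)) := mul_le_mul_of_nonneg_left hbr hkp.le
    simp only [twinFaultOnState]
    linarith
  have hωc : 0 < (Y 0).2 := by rw [h0]; exact lt_of_lt_of_le (by norm_num) hωlo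
  have hY1 : (Y 0).1 = (twinFaultOnState T).1 + π / 2 := by rw [h0]
  -- corner facts
  have hVcr := twinSAT_criticalEnergy_bounds.2
  rw [← hp] at hVcr
  have hDM : p.D / p.M = 5 / 2 := by rw [hpv]; norm_num
  have hωlo_D : p.D / p.M * (π - twinSAT_δ1 - 3037 / 1250) ≤ 36639 / 10000 := by rw [hDM]; nlinarith
  have hcos : cos (3037 / 1250 : ℝ) ≤ cosUpper4 (3037 / 1250) :=
    cos_le_cosUpper4 (by norm_num) (by linarith [pi_gt_three])
  have hPE : (497 / 500 : ℝ) ≤ p.potentialEnergy twinSAT_δ1 (3037 / 1250) := by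
    rw [hpv]
    unfold Literature.MathematicalPhysics.PowerSystems.SMIB.potentialEnergy
    norm_num [dbl, cosUpper4] at hcos hd1 hc1 ⊢
    nlinarith [hcos, hc1]
  have hKE : (1 : ℝ) / 2 * p.M * (36639 / 10000) ^ 2 = 151693044273 / 710000000000 := by rw [hpv]; norm_num
  have hallow : p.D * (36639 / 10000) * (π - twinSAT_δ1 - 3037 / 1250) ≤ 213 / 2500 := by
    rw [hpv]; dsimp only; nlinarith
  have hexcess0 : p.criticalEnergy twinSAT_δ1 + 1 / 100 + p.D * (36639 / 10000) * (π - twinSAT_δ1 - 3037 / 1250)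
      ≤ p.energy twinSAT_δ1 (3037 / 1250, 36639 / 10000) := by
    have hE : p.energy twinSAT_δ1 (3037 / 1250, 36639 / 10000)
        = 1 / 2 * p.M * (36639 / 10000) ^ 2 + p.potentialEnergy twinSAT_δ1 (3037 / 1250) := rfl
    rw [hE, hKE]
    norm_num at hVcr hPE hallow ⊢
    linarith
  by_cases hbeyond : π - twinSAT_δ1 < (Y 0).1
  · exact p.poleSlip_of_beyond_uep hM hD hPmax heq twinSAT_δ1_mem.2.le hXlit hbeyond hωc
  push Not at hbeyond
  rw [hY1] at hbeyond
  have hmono := p.excess_mono hM hD hPmax.le heq twinSAT_δ1_mem.1.le twinSAT_δ1_mem.2.le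
    (δ₁ := 3037 / 1250) (δ₂ := (twinFaultOnState T).1 + π / 2) (ω₁ := 36639 / 10000)
    (ω₂ := (twinFaultOnState T).2) (by linarith) hδlo hbeyond hωlo hωlo_D
  have hexcess : p.criticalEnergy twinSAT_δ1 + 1 / 100 +
      p.D * (Y 0).2 * (π - twinSAT_δ1 - (Y 0).1) ≤ p.energy twinSAT_δ1 (Y 0) := by
    rw [h0]
    dsimp only
    linarith
  exact p.poleSlip_of_excessEnergy hM hD hPmax heq twinSAT_δ1_mem.1.le twinSAT_δ1_mem.2 hXlit
    (by rw [hY1]; linarith) (by rw [hY1]; exact hbeyond) hωc (by norm_num : (0 : ℝ) < 1 / 100) hexcess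

/-- **The clearing-time BRACKET of MODEL M_twin+CSA: `0.24 s ≤ CCT ≤ 0.35 s`** (CSA active after clearing):
(i) every `T ∈ [0, 6/25]` relocks on the saturated branch; (ii) every `T ≥ 7/20` slips a pole.  VALIDATED RK4
`0.296 s` (latched or released by the printed rule); no printed comparator.  Nothing about a device. -/
theorem twinSAT_cct_bracket :
    (∀ T : ℝ, 0 ≤ T → T ≤ 6 / 25 → ∀ Y : ℝ → ℝ × ℝ, gfmQoriaV5sSAT.IsSolutionOn Y (Ici 0) →
        Y 0 = ((twinFaultOnState T).1 + π / 2, (twinFaultOnState T).2) →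
        (∀ t, 0 ≤ t → (Y t).1 ∈ Ioo (-π - twinSAT_δ1) (π - twinSAT_δ1) ∧
            gfmQoriaV5sSAT.energy twinSAT_δ1 (Y t) ≤ 1) ∧
          Tendsto Y atTop (𝓝 (twinSAT_δ1, 0))) ∧
    (∀ T : ℝ, 7 / 20 ≤ T → ∀ Y : ℝ → ℝ × ℝ, gfmQoriaV5sSAT.IsSolutionOn Y (Ici 0) →
        Y 0 = ((twinFaultOnState T).1 + π / 2, (twinFaultOnState T).2) →
        ∃ t : ℝ, 0 ≤ t ∧ π < (Y t).1 - twinSAT_δ1) :=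
  ⟨fun _ hT0 hT _ hY h0 => twinSAT_cct_lower hT0 hT hY h0,
    fun _ hT _ hY h0 => twinSAT_poleSlip_of_clearing_ge hT hY h0⟩

/-- **The certified RANKING of the three current-limiting cases of the `H_VSC = 5 s` twin** (Qoria Table V-2
«Transient stability: CSA −, VI +», established in print for `H ∼ 0`, here WITH the inertial effect, as four
clearing-time statements about the three MODELS): every `T ≥ 7/20` slips under the CSA while every `T ≤ 11/25`
relocks under the VI (★ #123 `twinVI_cct_lower`); every `T ≥ 29/50` slips under the VI (`twinVI_poleSlip…`) while
every `T ≤ 7/10` recovers without limiter (★ #114 `twin_cct_lower`):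
`CCT(M_twin+CSA) ≤ 0.35 < 0.44 ≤ CCT(M_twin+VI) ≤ 0.58 < 0.70 ≤ CCT(M_twin)`.  MODELLED: limiter latched in the
first two; nothing about a device. [cite: Qoria2020, Table V-2, §V.3.6] -/
theorem twin_limiter_ranking :
    (∀ T : ℝ, 7 / 20 ≤ T → ∀ Y : ℝ → ℝ × ℝ, gfmQoriaV5sSAT.IsSolutionOn Y (Ici 0) →
        Y 0 = ((twinFaultOnState T).1 + π / 2, (twinFaultOnState T).2) →
        ∃ t : ℝ, 0 ≤ t ∧ π < (Y t).1 - twinSAT_δ1) ∧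
    (∀ T : ℝ, 0 ≤ T → T ≤ 11 / 25 → ∀ Y : ℝ → ℝ × ℝ, gfmQoriaV5sVI.IsSolutionOn Y (Ici 0) →
        Y 0 = ((twinFaultOnState T).1 + qoriaV3VI_φ, (twinFaultOnState T).2) →
        Tendsto Y atTop (𝓝 (twinVI_δ1, 0))) ∧
    (∀ T : ℝ, 29 / 50 ≤ T → ∀ Y : ℝ → ℝ × ℝ, gfmQoriaV5sVI.IsSolutionOn Y (Ici 0) →
        Y 0 = ((twinFaultOnState T).1 + qoriaV3VI_φ, (twinFaultOnState T).2) →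
        ∃ t : ℝ, 0 ≤ t ∧ π < (Y t).1 - twinVI_δ1) ∧
    (∀ T : ℝ, 0 ≤ T → T ≤ 7 / 10 → ∀ X : ℝ → ℝ × ℝ, gfmQoriaV5sPhys.IsSolutionOn X (Ici 0) →
        X 0 = twinFaultOnState T → Tendsto X atTop (𝓝 (deltaQV4, 0))) ∧
    ((7 : ℝ) / 20 < 11 / 25 ∧ (29 : ℝ) / 50 < 7 / 10) :=
  ⟨fun _ hT _ hY h0 => twinSAT_poleSlip_of_clearing_ge hT hY h0,
    fun _ hT0 hT _ hY h0 => (twinVI_cct_lower hT0 hT hY h0).2,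
    fun _ hT _ hY h0 => twinVI_poleSlip_of_clearing_ge hT hY h0,
    fun _ hT0 hT _ hX h0 => (twin_cct_lower hT0 hT hX h0).2,
    ⟨by norm_num, by norm_num⟩⟩

end Summit.Ventures.GridStability.Models.SMIB

end
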